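/-
Copyright (c) 2026 the pub-hodgecm-mathlib formalisation cell (harness21).  Prover seat hodgecm-mathlib-LH7-p06 (g3), req620 Track A «(D-RAM) FOUR-FRAME» squad
((β₂) road (R-36), lane C (RamM) UPPER-LINE RAY PROGRAM v2 of LH7-p10 (g3), file G3′ for the DIAGONAL branch G8: digit constancy at an arbitrary radius), 2026-09-05.
-/
import Summits.HodgeConjecture.HodgeConjecture.Theorems.F0P3cDyRamUpperRayDigitConstancyGen     -- ★ G3 p865045 (this seat): the fixed-radius version (lineage; nothing used by name)
import HarnessLib

/-!
# Crux `H413`, line LH4 «(D-RAM) FOUR-FRAME» — (β₂) road, RAY bands of BOTH lanes, BOTH branches: «DIGIT CONSTANCY AT AN ARBITRARY RADIUS» — ★ G3 `…UpperRayDigitConstancyGen`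
# (`litStar_of_near`, `litStar_iff_of_near`) with the pair of letters `hRe : |ξ₀|·|cA| = |jEϖ|^b`, `hnear : |V′ − V| ≤ |ϖ|^{2d−1}` REPLACED by the ONE M-currency radius letter
# `hnear : |jE(V′ − V)|·|ξ₀|·|cA| ≤ |jEϖ|^{2d−1}·|jEϖ|^b` (file G3′ of LH7-p10 (g3)'s LANE-C RAY PROGRAM v2-G8, b4c9771c)

Cell `hodgecm-mathlib` (D-0151), FLOOR 0, crux item H413 = `stmt-HodgeConjecture-24833`, route of record `HCCMUnconditional`; squads F0∕P3c∕LH4 + LH7 (hand LH7-p06); lane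
`--supports stmt-HodgeConjecture-24833 --as helper` (count-neutral; pays NO tier-0 row).  THEOREMS ONLY (no `def`, no instance, no notation, no `sorry`, default heartbeats);
★-only imports; states NO law; (β₂) and the RAY-band letters stay HYPOTHESES.
WHY (LANEC-RAY-PROGRAM v2-G8 §0–§1).  On the DIAGONAL cells of lane C's top line (`j + 1 = b + s0`) every vertex has `|κ̂| = |κ₀|` and the reference pair satisfies
`|ξ₀|·|cA| = |jEϖ|^{b−1}` (★ G1 `refPair_diag_sizes`), so ★ G3's normalisation `hRe : |ξ₀|·|cA| = |jEϖ|^b` (`|κ̂| = |ξ₀|`) FAILS there, while the mechanism of ★ G3 only needs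
`|η| ≤ |jEϖ|^{2d−1}·|κ̂|` for the digit move `η = jE(V′ − V)·ξ₀`.  THIS FILE states exactly that: with `|κ̂|·|cA| = |jEϖ|^b` (the sphere clause of `LIT⋆ V` itself) the letter
`|jE(V′ − V)|·|ξ₀|·|cA| ≤ |jEϖ|^{2d−1}·|jEϖ|^b` is `|η|·|cA| ≤ |jEϖ|^{2d−1}·|κ̂|·|cA|`; everything after (the twist `w = κ̂′ρκ̂′∕(κ̂ρκ̂)`, `|w − 1| ≤ |jEϖ|^{2d−1}`, `hdeep`) is ★ G3's
proof VERBATIM.  SIGNATURE = ★ G3's with `hRe` and `hnear` REPLACED by the one radius letter (in `hnear`'s position) and the two binders that thereby fall idle DROPPED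
(`hjv` — no `E → M` transport is left — and `hξ0 : ξ₀ ≠ 0` — `κ̂ ≠ 0` now comes from the sphere clause); `hlt : |jEϖ|^{2d−1} < 1` and `hϖ0 : jEϖ ≠ 0` kept; binder ORDER
otherwise ★ G3's; conclusions BYTE-IDENTICAL.  Serves the generic branch (`hRe` + `|V′ − V| ≤ |ϖ|^{2d−1}` ⇒ the letter) and the diagonal branch (`|ξ₀|·|cA| = |jEϖ|^{b−1}` +
`|V′ − V| ≤ |ϖ|^{2d}` ⇒ the letter).
* §1 `litStar_of_near_of_radius` (one direction), HEAD `litStar_iff_of_near_of_radius`.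
HONEST LABEL.  Count-neutral algebra; nothing printed is asserted; no census law is stated; ‹HU_RAY_C♮-diag›, lane B∕C RAY payers, β₂ `stub_law_cleanSgn₂` stay OPEN∕HYPOTHESES;
`HC_CM` is proved only modulo the 7 printed citations (2 remaining named inputs: hLiu418 = `stmt-HodgeConjecture-24832`, h413 = `stmt-HodgeConjecture-24833`) until rung 0 closes.
## References
* [Serre1979] J.-P. Serre, *Local Fields*, GTM 67 (1979): Ch. V §3 Cor. 3 pp. 85–87 (norm groups `U^{(n)} ⊆ N` for `n ≥ 2d − 1`; conductor of `ω`), Ch. XV §2.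
* [Rogawski1990] J. D. Rogawski, *Automorphic Representations of Unitary Groups in Three Variables*, Ann. of Math. Stud. 123 (1990): §4.9 Prop. 4.9.1 (b) p. 55.
* [Kottwitz1986BaseChangeUnits] R. E. Kottwitz, *Base change for unit elements of Hecke algebras*, Compositio Math. 60 (1986): §3 (the digit fibration of a cone cell).
-/

set_option autoImplicit false

noncomputable section

namespace Summit.HodgeConjecture.HodgeConjecture.Cruxes.H413.F0P3cDyRamUpperRayDigitConstancyRadius

open scoped Valued WithZero
open WithZero

variable {E M : Type} [Field E] [Field M] [Valued M ℤᵐ⁰] {ρ Θ : M →+* M}   -- no valuation on `E` is used: the radius letter lives in `M`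

/-! ## §1 `LIT⋆` is constant along digit moves below the radius — one letter, both branches -/

/-- **ONE DIRECTION OF THE HEAD** (the statement is symmetric in `V, V′`): `LIT⋆ V → LIT⋆ V′` for fixed digits `V, V′` under the radius letter
`|jE(V′ − V)|·|ξ₀|·|cA| ≤ |jEϖ|^{2d−1}·|jEϖ|^b`, the reference pair and the norm letter at depth `2d − 1` — ★ G3 `litStar_of_near` with `hRe` + `hnear` ↦ the radius letter.
[cite: Serre1979, Ch. V §3 Cor. 3 pp. 85–87] [cite: Rogawski1990, §4.9 Prop. 4.9.1 (b) p. 55] -/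
theorem litStar_of_near_of_radius {σ : E →+* E} {ϖ : E} {d : ℕ}
    (jE : E →+* M) (hjfix : ∀ z, ρ z = z ↔ ∃ c, jE c = z) (hΘj : ∀ c, Θ (jE c) = jE (σ c))
    (hρρ : ∀ x, ρ (ρ x) = x) (hvρ : ∀ x, Valued.v (ρ x) = Valued.v x) (hΘρ : ∀ x, Θ (ρ x) = ρ (Θ x))
    {κ₀ ξ₀ : M} (hκ₀ : κ₀ + ρ κ₀ = 1) (hΘκ₀ : Θ κ₀ = κ₀) (hξ : ρ ξ₀ = -ξ₀) (hΘξ : Θ ξ₀ = ξ₀)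
    {cA hM : M} {b : ℕ} (hϖ0 : jE ϖ ≠ 0)
    (hdeep : ∀ u : M, ρ u = u → Θ u = u → Valued.v (u - 1) ≤ Valued.v (jE ϖ) ^ (2 * d - 1) → ∃ c : M, ρ c = c ∧ c * Θ c = u)
    {V V' : E} (hσV : σ V = V) (hσV' : σ V' = V')
    (hnear : Valued.v (jE (V' - V)) * Valued.v ξ₀ * Valued.v cA ≤ Valued.v (jE ϖ) ^ (2 * d - 1) * Valued.v (jE ϖ) ^ b) (hlt : Valued.v (jE ϖ) ^ (2 * d - 1) < 1)
    (hL : Valued.v (κ₀ + jE V * ξ₀) * Valued.v cA = Valued.v (jE ϖ) ^ b ∧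
      ∃ e : M, ρ e = e ∧ e * Θ e = (κ₀ + jE V * ξ₀) * ρ (κ₀ + jE V * ξ₀) / (hM * ρ hM)) :
    Valued.v (κ₀ + jE V' * ξ₀) * Valued.v cA = Valued.v (jE ϖ) ^ b ∧
      ∃ e : M, ρ e = e ∧ e * Θ e = (κ₀ + jE V' * ξ₀) * ρ (κ₀ + jE V' * ξ₀) / (hM * ρ hM) := by
  obtain ⟨hLv, e, hρe, he⟩ := hL
  have hρj : ∀ c : E, ρ (jE c) = jE c := fun c => (hjfix _).2 ⟨c, rfl⟩
  have hpow0 : Valued.v (jE ϖ) ^ b ≠ 0 := pow_ne_zero _ ((Valuation.ne_zero_iff _).2 hϖ0)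
  have hcA0 : Valued.v cA ≠ 0 := fun h0 => by rw [h0, mul_zero] at hLv; exact hpow0 hLv.symm
  have hcApos : (0 : ℤᵐ⁰) < Valued.v cA := zero_lt_iff.2 hcA0
  set κ : M := κ₀ + jE V * ξ₀ with hκdef
  set η : M := jE (V' - V) * ξ₀ with hηdef
  have hκ' : κ₀ + jE V' * ξ₀ = κ + η := by rw [hκdef, hηdef, map_sub]; ring
  -- sizes: `|κ|·|cA| = |jEϖ|^b` (this is `hL.1`), `|η| ≤ |jEϖ|^{2d−1}·|κ| < |κ|` (the radius letter divided by `|cA| > 0`)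
  have hvκ0 : Valued.v κ ≠ 0 := fun h0 => by rw [h0, zero_mul] at hLv; exact hpow0 hLv.symm
  have hκ0 : κ ≠ 0 := (Valuation.ne_zero_iff _).1 hvκ0
  have hκpos1 : (0 : ℤᵐ⁰) < Valued.v κ := zero_lt_iff.2 hvκ0
  have hηv : Valued.v η ≤ Valued.v (jE ϖ) ^ (2 * d - 1) * Valued.v κ := by
    refine le_of_mul_le_mul_right ?_ hcApos
    rw [hηdef, Valuation.map_mul, mul_assoc (Valued.v (jE ϖ) ^ (2 * d - 1)), hLv]; exact hnear
  have hηlt : Valued.v η < Valued.v κ := by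
    refine hηv.trans_lt ?_
    calc Valued.v (jE ϖ) ^ (2 * d - 1) * Valued.v κ < 1 * Valued.v κ := mul_lt_mul_of_pos_right hlt hκpos1
      _ = Valued.v κ := one_mul _
  have hρκ : ρ κ = 1 - κ := by
    rw [hκdef, map_add, map_mul, hρj, hξ, mul_neg, ← hκ₀]; ring
  have hρκ0 : ρ κ ≠ 0 := fun h0 => hκ0 (by rw [← hρρ κ, h0, map_zero])
  have hρη : ρ η = -η := by rw [hηdef, map_mul, hρj, hξ, mul_neg]
  have hΘκ : Θ κ = κ := by rw [hκdef, map_add, map_mul, hΘκ₀, hΘj, hσV, hΘξ]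
  have hΘη : Θ η = η := by rw [hηdef, map_mul, hΘj, map_sub, hσV, hσV', hΘξ, map_sub]
  -- the twist `w = κ′ρκ′ ∕ (κρκ)`
  set w : M := (κ + η) * ρ (κ + η) / (κ * ρ κ) with hwdef
  have hρw : ρ w = w := by
    rw [hwdef, map_div₀, map_mul, map_mul, hρρ, hρρ]; ring
  have hΘw : Θ w = w := by
    rw [hwdef, map_div₀, map_mul, map_mul, hΘρ, hΘρ, map_add, hΘκ, hΘη]
  have hw1 : w - 1 = (η * (ρ κ - κ) - η * η) / (κ * ρ κ) := by
    rw [hwdef, map_add, hρη]; field_simp; ring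
  have hwv : Valued.v (w - 1) ≤ Valued.v (jE ϖ) ^ (2 * d - 1) := by
    rw [hw1, Valuation.map_div, Valuation.map_mul, hvρ]
    have hκpos : (0 : ℤᵐ⁰) < Valued.v κ * Valued.v κ := mul_pos hκpos1 hκpos1
    rw [div_le_iff₀ hκpos]
    have h1 : Valued.v (η * (ρ κ - κ)) ≤ Valued.v (jE ϖ) ^ (2 * d - 1) * (Valued.v κ * Valued.v κ) := by
      rw [Valuation.map_mul, ← mul_assoc]
      refine mul_le_mul' hηv ((Valuation.map_sub _ _ _).trans (max_le (by rw [hvρ]) le_rfl))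
    have h2 : Valued.v (η * η) ≤ Valued.v (jE ϖ) ^ (2 * d - 1) * (Valued.v κ * Valued.v κ) := by
      rw [Valuation.map_mul, ← mul_assoc]; exact mul_le_mul' hηv hηlt.le
    exact (Valuation.map_sub _ _ _).trans (max_le h1 h2)
  obtain ⟨c, hρc, hc⟩ := hdeep w hρw hΘw hwv
  refine ⟨?_, c * e, by rw [map_mul, hρc, hρe], ?_⟩
  · rw [hκ', Valuation.map_add_eq_of_lt_left _ hηlt]; exact hLv
  · have hcc : c * e * Θ (c * e) = w * ((κ + η - η) * ρ (κ + η - η) / (hM * ρ hM)) := by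
      rw [map_mul, add_sub_cancel_right, ← he, ← hc]; ring
    rw [hcc, hκ', hwdef, add_sub_cancel_right]
    field_simp

/-- **HEAD — «`LIT⋆` IS CONSTANT ALONG DIGIT MOVES BELOW THE RADIUS `|jEϖ|^{2d−1}·|jEϖ|^b ∕ (|ξ₀|·|cA|)`».**  `jE`-letters (`Fix ρ = jE(E)`, `Θ∘jE = jE∘σ`), `ρ ∘ ρ = 1`, `ρ`
isometric, `Θρ = ρΘ`; the reference pair `κ₀, ξ₀` (`Tr_ρ κ₀ = 1`, `Θκ₀ = κ₀`, `ρξ₀ = −ξ₀`, `Θξ₀ = ξ₀`); `jEϖ ≠ 0`; the norm letter `hdeep` at depth `2d − 1`; `|jEϖ|^{2d−1} < 1`.  THEN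
for fixed `V, V′` with the ONE M-currency radius letter `|jE(V′ − V)|·|ξ₀|·|cA| ≤ |jEϖ|^{2d−1}·|jEϖ|^b`: `LIT⋆ V ↔ LIT⋆ V′`,
`LIT⋆ V :≡ |κ₀ + jE V·ξ₀|·|cA| = |jEϖ|^b ∧ ∃ e ∈ Fix ρ, eΘe = κ̂ρκ̂∕(hρh)` — ★ G3 `litStar_iff_of_near` with `hRe` + `hnear` replaced by the radius letter (generic branch:
`hRe` and `|V′ − V| ≤ |ϖ|^{2d−1}` give it; DIAGONAL branch: `|ξ₀|·|cA| = |jEϖ|^{b−1}` and `|V′ − V| ≤ |ϖ|^{2d}` give it).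
[cite: Serre1979, Ch. V §3 Cor. 3 pp. 85–87] [cite: Rogawski1990, §4.9 Prop. 4.9.1 (b) p. 55] [cite: Kottwitz1986BaseChangeUnits, §3] -/
theorem litStar_iff_of_near_of_radius {σ : E →+* E} {ϖ : E} {d : ℕ}
    (jE : E →+* M) (hjfix : ∀ z, ρ z = z ↔ ∃ c, jE c = z) (hΘj : ∀ c, Θ (jE c) = jE (σ c))
    (hρρ : ∀ x, ρ (ρ x) = x) (hvρ : ∀ x, Valued.v (ρ x) = Valued.v x) (hΘρ : ∀ x, Θ (ρ x) = ρ (Θ x))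
    {κ₀ ξ₀ : M} (hκ₀ : κ₀ + ρ κ₀ = 1) (hΘκ₀ : Θ κ₀ = κ₀) (hξ : ρ ξ₀ = -ξ₀) (hΘξ : Θ ξ₀ = ξ₀)
    {cA hM : M} {b : ℕ} (hϖ0 : jE ϖ ≠ 0)
    (hdeep : ∀ u : M, ρ u = u → Θ u = u → Valued.v (u - 1) ≤ Valued.v (jE ϖ) ^ (2 * d - 1) → ∃ c : M, ρ c = c ∧ c * Θ c = u)
    {V V' : E} (hσV : σ V = V) (hσV' : σ V' = V')
    (hnear : Valued.v (jE (V' - V)) * Valued.v ξ₀ * Valued.v cA ≤ Valued.v (jE ϖ) ^ (2 * d - 1) * Valued.v (jE ϖ) ^ b) (hlt : Valued.v (jE ϖ) ^ (2 * d - 1) < 1) :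
    (Valued.v (κ₀ + jE V * ξ₀) * Valued.v cA = Valued.v (jE ϖ) ^ b ∧
        ∃ e : M, ρ e = e ∧ e * Θ e = (κ₀ + jE V * ξ₀) * ρ (κ₀ + jE V * ξ₀) / (hM * ρ hM)) ↔
      (Valued.v (κ₀ + jE V' * ξ₀) * Valued.v cA = Valued.v (jE ϖ) ^ b ∧
        ∃ e : M, ρ e = e ∧ e * Θ e = (κ₀ + jE V' * ξ₀) * ρ (κ₀ + jE V' * ξ₀) / (hM * ρ hM)) := by
  have hnear' : Valued.v (jE (V - V')) * Valued.v ξ₀ * Valued.v cA ≤ Valued.v (jE ϖ) ^ (2 * d - 1) * Valued.v (jE ϖ) ^ b := by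
    rw [← neg_sub, map_neg, Valuation.map_neg]; exact hnear
  exact ⟨litStar_of_near_of_radius jE hjfix hΘj hρρ hvρ hΘρ hκ₀ hΘκ₀ hξ hΘξ hϖ0 hdeep hσV hσV' hnear hlt,
    litStar_of_near_of_radius jE hjfix hΘj hρρ hvρ hΘρ hκ₀ hΘκ₀ hξ hΘξ hϖ0 hdeep hσV' hσV hnear' hlt⟩

end Summit.HodgeConjecture.HodgeConjecture.Cruxes.H413.F0P3cDyRamUpperRayDigitConstancyRadius

end
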